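import Summits.MatrixMultiplication.OmegaCensus.STPPKernelListerOrderN49DP1

/-!
# ω-census (abelian STPP census): kernel lister — ORDER capstone at `n = 49` MODULO the 9 tree-law survivor pattern(s) (part 5 of 7: root computation over `selN49P5`)

HONEST FRAMING (pub-omega census; verbatim): lottery ticket; floor = certified bounds/negative ranges.
Census STRUCTURE (seat pub-omega-stpp-2 gen 30, 2026-08-29), family (b2).  Nothing here is progress on `ω`.  CONDITIONAL THEOREM: for every
finite abelian group `H` of order `49`, IF none of the 9 size patterns of `deadN49` (`233_244`, `333_333`, `112_234_324`, `112_243_243`, `112_243_342`, `112_243_423`, `224_233_242`, `111_111_234_324`, `112_223_332_332`) is realisable in `H` as an STPP family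
(CKSU Def. 5.1), THEN every STPP family of `H` has `Σ |Aᵢ||Bᵢ||Cᵢ| ≤ 49` (no beating family, no `ω < 3` via CKSU Thm. 5.5).  The dead list is
EXACTLY the set of minimal beating size patterns (canonical classes, all block counts, all entries) that survive the seven tree laws of the kernel
lister at order `49` (single-block volume, representation count, N7, N16, N8 = Kneser over all divisors, N18, N12) — i.e. the residual census
obligation at order `49` is reduced to deciding these 9 explicit patterns per group (by search engines or future kernel kills).  Mechanism:
`KLister.volume_le_of_scan_list_dead` (`STPPKernelListerOrderKitD`) over the root computation with this dead list, split over 7 first-block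
selection(s) (`decide +kernel`; python twin `gen_orderD.py`/`klister_lean.py`, 853894 calls, canonical-equality dead test, fixpoint in 2 round(s)).
-/

open Finset

namespace Summit.MatrixMultiplication.OmegaCensus.KLister

open Literature.Computability.AlgebraicComplexity


/-- First blocks of part 5 of the root computation at order `49`. [folklore] -/
def selN49P5 : List Shape := [(2, 3, 3), (3, 2, 3), (3, 3, 2)]

set_option maxRecDepth 32768 in
set_option maxHeartbeats 4000000 in
/-- Root computation of the kernel lister at order `49` with the dead list `deadN49`, first blocks in `selN49P5`: `true` (twin 119245 calls). [folklore] -/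
theorem scan_N49P5 : scanFirstC 49 deadN49 (fun s => selN49P5.contains s) chunksN49 = true := by
  decide +kernel

end Summit.MatrixMultiplication.OmegaCensus.KLister
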